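import Summits.ValiantsHypothesis.ValiantsHypothesis.Theorems.NewtonUnitEquationsTwoProductsConfinedTameLawDefs
import HarnessLib

/-!
# R10 (`positive-circuit-chart`) — `SliceCountBound` (the last typed statement of val-idea-37's sketch): the number of relation
patterns `(msetT a).filter (· ∈ L)` over the tuples of a letter family is at most `C(#L + m, m)` (stars and bars: a pattern is a
multiset of ≤ m letters of `L`; padding with a slack symbol embeds it into `Sym (Fin (#L+1)) m`).
R275 P3 scope: tool; nothing here closes 5906; VP ≠ VNP is NOT proved.
-/

noncomputable section
set_option linter.dupNamespace false
set_option linter.unusedSectionVars false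

namespace Summit.ValiantsHypothesis.ValiantsHypothesis.Theorems.NewtonUnitEquations.TwoProducts.PermutationType
namespace R10
open scoped BigOperators
open MvPolynomial
open Summit.ValiantsHypothesis.ValiantsHypothesis.Theorems.NewtonUnitEquations.TwoProducts.FormalLogLinearisation
open Summit.ValiantsHypothesis.ValiantsHypothesis.Theorems.NewtonUnitEquations.TwoProducts.PlanarCell

variable {m : ℕ}

/-- The letter multiset of a tuple has at most `m` letters (counted with multiplicity). [folklore] -/
theorem sum_msetT_le (a : Fin m → Expo) : ((msetT a).sum fun _ k => k) ≤ m := by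
  classical
  have h : ((msetT a).sum fun _ k => k) = Multiset.card (Finsupp.toMultiset (msetT a)) := by
    rw [Finsupp.card_toMultiset]; rfl
  rw [h]
  unfold msetT
  rw [Finsupp.toMultiset_sum, Multiset.card_sum]
  calc ∑ j, Multiset.card (Finsupp.toMultiset (if a j = 0 then (0 : Expo →₀ ℕ) else Finsupp.single (a j) 1))
      ≤ ∑ _j : Fin m, 1 := Finset.sum_le_sum fun j _ => by
        split_ifs
        · simp
        · rw [Finsupp.toMultiset_single]; simp
    _ = m := by simp

/-- Mass of a filtered pattern is at most the mass of the pattern. [folklore] -/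
theorem sum_filter_le (p : Expo →₀ ℕ) (L : Finset Expo) :
    ((p.filter (· ∈ L)).sum fun _ k => k) ≤ p.sum fun _ k => k := by
  classical
  have hsub : (p.filter (· ∈ L)).support ⊆ p.support := by
    intro e he; rw [Finsupp.support_filter] at he; exact (Finset.mem_filter.mp he).1
  rw [Finsupp.sum_of_support_subset (p.filter (· ∈ L)) hsub _ (fun _ _ => rfl),
    Finsupp.sum_of_support_subset p subset_rfl _ (fun _ _ => rfl)]
  exact Finset.sum_le_sum fun e _ => by rw [Finsupp.filter_apply]; split_ifs <;> simp

/-- The total mass of a pattern supported on `L`, summed over `L.attach`. [folklore] -/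
theorem sum_attach_eq (p : Expo →₀ ℕ) (L : Finset Expo) (hp : p.support ⊆ L) :
    ∑ x ∈ L.attach, p x.1 = p.sum fun _ k => k := by
  classical
  rw [Finset.sum_attach L (fun e => p e), Finsupp.sum_of_support_subset p hp _ (fun _ _ => rfl)]

/-- **The padded multiset** of a pattern: letters of `L` are indexed by `Fin.succ ∘ L.equivFin`, the slack symbol is `0`. [folklore] -/
def padM (L : Finset Expo) (m : ℕ) (p : Expo →₀ ℕ) : Multiset (Fin (L.card + 1)) :=
  (∑ x ∈ L.attach, p x.1 • ({Fin.succ (L.equivFin x)} : Multiset (Fin (L.card + 1)))) +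
    (m - p.sum fun _ k => k) • ({0} : Multiset (Fin (L.card + 1)))

/-- Its size is `m` when the pattern is supported on `L` with mass `≤ m`. [folklore] -/
theorem card_padM (L : Finset Expo) (m : ℕ) (p : Expo →₀ ℕ) (hp : p.support ⊆ L) (hm : (p.sum fun _ k => k) ≤ m) :
    Multiset.card (padM L m p) = m := by
  classical
  unfold padM
  rw [Multiset.card_add, Multiset.card_sum, Multiset.card_nsmul, Multiset.card_singleton, mul_one]
  simp only [Multiset.card_nsmul, Multiset.card_singleton, mul_one]
  rw [sum_attach_eq p L hp]
  omega

/-- Letter counts are recovered from the padded multiset. [folklore] -/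
theorem count_padM (L : Finset Expo) (m : ℕ) (p : Expo →₀ ℕ) (x : ↥L) :
    Multiset.count (Fin.succ (L.equivFin x)) (padM L m p) = p x.1 := by
  classical
  unfold padM
  rw [Multiset.count_add, Multiset.count_sum', Multiset.count_nsmul, Multiset.count_singleton,
    if_neg (Fin.succ_ne_zero _), mul_zero, add_zero]
  rw [Finset.sum_eq_single x]
  · rw [Multiset.count_nsmul, Multiset.count_singleton_self, mul_one]
  · intro y _ hyx
    rw [Multiset.count_nsmul, Multiset.count_singleton, if_neg, mul_zero]
    intro h
    exact hyx ((L.equivFin).injective (Fin.succ_injective _ h)).symm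
  · intro h; exact absurd (Finset.mem_attach L x) h

/-- **`SliceCountBound` holds**: `#patterns ≤ C(#L + m, m)`. [folklore] -/
theorem sliceCountBound_holds : R10Defs.SliceCountBound := by
  classical
  intro m A L
  set Pat := (tuples A).image fun a => (msetT a).filter (· ∈ L) with hPat
  have hprops : ∀ p ∈ Pat, p.support ⊆ L ∧ (p.sum fun _ k => k) ≤ m := by
    intro p hp
    obtain ⟨a, -, rfl⟩ := Finset.mem_image.mp hp
    refine ⟨fun e he => ?_, (sum_filter_le _ L).trans (sum_msetT_le a)⟩
    rw [Finsupp.support_filter] at he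
    exact (Finset.mem_filter.mp he).2
  -- the injection into Sym (Fin (#L+1)) m
  let f : (Expo →₀ ℕ) → Sym (Fin (L.card + 1)) m := fun p =>
    if h : Multiset.card (padM L m p) = m then ⟨padM L m p, h⟩ else ⟨Multiset.replicate m 0, Multiset.card_replicate _ _⟩
  have hinj : Set.InjOn f ↑Pat := by
    intro p hp q hq hpq
    obtain ⟨hpL, hpm⟩ := hprops p hp
    obtain ⟨hqL, hqm⟩ := hprops q hq
    have hcp := card_padM L m p hpL hpm
    have hcq := card_padM L m q hqL hqm
    have hM : padM L m p = padM L m q := by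
      have := congrArg (fun s : Sym (Fin (L.card + 1)) m => (s : Multiset (Fin (L.card + 1)))) hpq
      simpa [f, hcp, hcq] using this
    ext e
    by_cases he : e ∈ L
    · have := count_padM L m p ⟨e, he⟩
      rw [hM, count_padM L m q ⟨e, he⟩] at this
      exact this.symm
    · have hp0 : p e = 0 := by
        by_contra h; exact he (hpL (Finsupp.mem_support_iff.mpr h))
      have hq0 : q e = 0 := by
        by_contra h; exact he (hqL (Finsupp.mem_support_iff.mpr h))
      rw [hp0, hq0]
  calc Pat.card ≤ (Finset.univ : Finset (Sym (Fin (L.card + 1)) m)).card :=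
        Finset.card_le_card_of_injOn f (fun _ _ => Finset.mem_univ _) hinj
    _ = (L.card + m).choose m := by
        rw [Finset.card_univ, Sym.card_sym_eq_choose, Fintype.card_fin]
        congr 1; omega

end R10
end Summit.ValiantsHypothesis.ValiantsHypothesis.Theorems.NewtonUnitEquations.TwoProducts.PermutationType

end
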